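import Summits.MatrixMultiplication.MatrixMultiplication.Theorems.SaturationLadderFamilyConstant
import HarnessLib

/-!
# SaturationLadder — twin-class ceiling (1/3): the two entropy inequalities of the pencil, as real analysis

Route `SaturationLadder` (sub-problem `MatrixMultiplication`), crux `SubexpSaturation`
(stmt-MatrixMultiplication-25909) `⟺ ∀ θ > 1, Base(θ)`
(`SaturationLadderBaseFamily.subexpSaturation_iff_forall_base`).  This is the analytic core of the
three-file move `…TwinCeilingCore → …TwinCeilingPencil → …TwinCeiling`, which types the whole
ONE-PARAMETER PENCIL of twin families `κ = p/q ∈ [0,1]` (the landed STAGE-2 family of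
`SaturationLadderTwinFamily` is `κ = 17/20`) and proves `Base(θ)` for EVERY `θ³ > 3125/128`, moving the
theorem frontier of the base ladder from `2^{47/30} = 2.9622…` (`base_of_ge_family`) to the
twin-class ceiling `(3125/128)^{1/3} = 2.90099…`.

Along the pencil the three laws entering `omegaRect_one_tw_exact` are, in units of `1/d`
(`d = B + 3`, `B = 2^{j+1}`, `ε = 1/j`):  `Z = (2, B, 1)`;  `Y = (α, d − τ, γ)` with
`α = 5/2 + (1+κ)ε`, `γ = 1/2 − ε`, `τ = 3 + κε`;  `X = (d − σ, σ, 0)` with `σ = 3 + (2+κ)ε`.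
For `κ ∈ [0,1]`, `ε ≤ 1/1000`, `B ≥ 2^65`, `εB ≥ 1` and `30 ε ≤ δ(κ)`, where

  `δ(κ) := (5/2 + κ) log 2 − (5/2) log (5/2)`   (the `Y`-threshold; `δ > 0 ⟺ κ > 0.8048…`),

* `coreY` : `Σ negMulLog Z ≤ Σ negMulLog Y`   (margin `d·ΔH ≥ δ − 27.6 ε` nats);
* `coreX` : `Σ negMulLog Z ≤ Σ negMulLog X`   (margin `d·ΔH ≥ δ + 0.014 − 26.3 ε`;
  `thresholdX_sub_thresholdY` places the `X`-threshold `3 log₂ 3 − 4 = 0.7549…` below the `Y`-one);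

with `le_log_five_halves : 0.9158 ≤ log (5/2)` and the `Z`-side closed form / bound `zSide_eq`,
`zSide_le`.  Pattern of `SaturationLadderTwinSaturation.familyY` / `SaturationLadderTwinFamilyX.familyX`
with the constant `17/20` replaced by a real parameter `κ` (cell `decomp-mm`, lens 1 «grading /
quantitative ladder», gen 14).  No definitions, no named facts, no sorry.
-/

set_option linter.dupNamespace false
-- (single-conjunct summit: the namespace repeats `MatrixMultiplication`)

noncomputable section

namespace Summit.MatrixMultiplication.MatrixMultiplication.Theorems.SaturationLadderTwinCeilingCore

open Summit.MatrixMultiplication.MatrixMultiplication.Theorems.SaturationLadderTwinFamilyX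
  (log_three_le)
open Summit.MatrixMultiplication.MatrixMultiplication.Theorems.SaturationLadderTwinSaturation
  (log_five_halves_le)

/-! ## A lower numerical bound for `log (5/2)` -/

/-- `0.9158 ≤ log (5/2)` (`log (5/2) = log 2 − log(1 − 1/5)`, four Taylor terms). [folklore] -/
theorem le_log_five_halves : (0.9158 : ℝ) ≤ Real.log (5 / 2) := by
  have h := Real.abs_log_sub_add_sum_range_le (x := (1 / 5 : ℝ))
    (by rw [abs_of_pos (by norm_num)]; norm_num) 4
  rw [abs_le] at h
  have h2 := h.2
  simp only [Finset.sum_range_succ, Finset.sum_range_zero] at h2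
  norm_num [abs_of_pos] at h2
  have e : Real.log (5 / 2) = Real.log 2 - Real.log (4 / 5) := by
    rw [← Real.log_div (by norm_num) (by norm_num)]; norm_num
  have hl2 := Real.log_two_gt_d9
  rw [e]; linarith

/-- `(3/2) log 2 − 3 log 3 + (5/2) log (5/2) ≥ 0.014`: the `X`-threshold of the pencil lies `0.014`
below its `Y`-threshold (`(4+κ) log 2 − 3 log 3 = δ(κ) + this`). [folklore] -/
theorem thresholdX_sub_thresholdY :
    (0.014 : ℝ) ≤ 3 / 2 * Real.log 2 - 3 * Real.log 3 + 5 / 2 * Real.log (5 / 2) := by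
  have hl2 := Real.log_two_gt_d9
  have hl3 := log_three_le
  have hP := le_log_five_halves
  linarith

/-! ## The two entropy inequalities as real-analysis lemmas

Parameters: `κ ∈ [0,1]` (the pencil), `ε = 1/j ≤ 1/1000` with `30 ε ≤ δ(κ)`, `B = 2^{j+1}` (only
`log B = (j+1) log 2`, `B ≥ 2^65` and `ε B ≥ 1` are used), `d = B + 3`; the laws are
`Z = (2, B, 1)/d`, `X = (d − σ, σ, 0)/d` with `σ = 3 + (2+κ) ε`, and `Y = (α, d − τ, γ)/d` with
`α = 5/2 + (1+κ) ε`, `γ = 1/2 − ε`, `τ = α + γ = 3 + κ ε` (entropies in nats, `0 log 0` dropped). -/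

/-- The `Z`-side in closed form: `Σ negMulLog = (log d − log B) + (3j+1) log 2 / d`. [folklore] -/
theorem zSide_eq (j B d : ℝ) (hBpos : 0 < B) (hd : d = B + 3)
    (hlogB : Real.log B = (j + 1) * Real.log 2) :
    Real.negMulLog (2 / d) + Real.negMulLog (B / d) + Real.negMulLog (1 / d) =
      (Real.log d - Real.log B) + ((3 * j + 1) * Real.log 2) / d := by
  have hdpos : 0 < d := by rw [hd]; linarith
  simp only [Real.negMulLog, Real.log_div two_ne_zero hdpos.ne', Real.log_div hBpos.ne' hdpos.ne',
    Real.log_div one_ne_zero hdpos.ne', Real.log_one]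
  rw [hlogB]
  field_simp
  rw [hd]
  ring

/-- The `Z`-side bound: `Σ negMulLog ≤ 3/B + (3j+1) log 2 / d` (`log(d/B) ≤ d/B − 1 = 3/B`). [folklore] -/
theorem zSide_le (j B d : ℝ) (hBpos : 0 < B) (hd : d = B + 3)
    (hlogB : Real.log B = (j + 1) * Real.log 2) :
    Real.negMulLog (2 / d) + Real.negMulLog (B / d) + Real.negMulLog (1 / d) ≤
      3 / B + ((3 * j + 1) * Real.log 2) / d := by
  rw [zSide_eq j B d hBpos hd hlogB]
  have hdpos : 0 < d := by rw [hd]; linarith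
  have h1 : Real.log d - Real.log B ≤ 3 / B := by
    rw [← Real.log_div hdpos.ne' hBpos.ne']
    have := Real.log_le_sub_one_of_pos (show 0 < d / B by positivity)
    have e : d / B - 1 = 3 / B := by rw [hd]; field_simp; ring
    linarith
  linarith

/-- `p − p² ≤ negMulLog (1 − p)` for `p < 1` (`log(1−p) ≤ −p`). [folklore] -/
theorem sub_sq_le_negMulLog_one_sub {p : ℝ} (hp : p < 1) :
    p - p ^ 2 ≤ Real.negMulLog (1 - p) := by
  have h1p : 0 < 1 - p := by linarith
  have hlog : Real.log (1 - p) ≤ -p := by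
    have := Real.log_le_sub_one_of_pos h1p; linarith
  simp only [Real.negMulLog]
  linear_combination mul_le_mul_of_nonneg_left hlog h1p.le

set_option maxHeartbeats 800000 in
/-- **`Y`-core: `H(Z) ≤ H(Y)` along the pencil**, for `κ ∈ [0,1]`, `ε ≤ 1/1000`, `30 ε ≤ δ(κ)`.
[cite: CoppersmithWinograd1990, §8] [cite: AlmanDuanVassilevskaWilliamsXuXuZhou2025, §3.4] -/
theorem coreY (κ ε j B d α γ τ : ℝ) (hκ0 : 0 ≤ κ) (hκ1 : κ ≤ 1) (hε0 : 0 < ε)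
    (hεle : ε ≤ 1 / 1000) (hεJ : ε * j = 1)
    (hεδ : 30 * ε ≤ (5 / 2 + κ) * Real.log 2 - 5 / 2 * Real.log (5 / 2))
    (hB65 : (2 : ℝ) ^ 65 ≤ B) (hBε : 1 ≤ ε * B) (hlogB : Real.log B = (j + 1) * Real.log 2)
    (hd : d = B + 3) (hα : α = 5 / 2 + (1 + κ) * ε) (hγ : γ = 1 / 2 - ε) (hτ : τ = 3 + κ * ε) :
    Real.negMulLog (2 / d) + Real.negMulLog (B / d) + Real.negMulLog (1 / d) ≤
      Real.negMulLog (α / d) + Real.negMulLog (1 - τ / d) + Real.negMulLog (γ / d) := by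
  have hBpos : 0 < B := lt_of_lt_of_le (by positivity) hB65
  have hdpos : 0 < d := by rw [hd]; linarith
  have hBd : B ≤ d := by rw [hd]; linarith
  have hjε : j = 1 / ε := by rw [eq_div_iff hε0.ne']; linarith only [hεJ]
  have hjpos : 0 < j := by rw [hjε]; positivity
  have hαpos : 0 < α := by rw [hα]; positivity
  have hγpos : 0 < γ := by rw [hγ]; linarith only [hεle]
  have hκε : 0 ≤ κ * ε := by positivity
  have hκε' : κ * ε ≤ 1 / 1000 :=
    calc κ * ε ≤ 1 * ε := mul_le_mul_of_nonneg_right hκ1 hε0.le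
      _ ≤ 1 / 1000 := by rw [one_mul]; exact hεle
  have hτ3 : 3 ≤ τ := by rw [hτ]; linarith only [hκε]
  have hτ4 : τ ≤ 4 := by rw [hτ]; linarith only [hκε']
  have hd65 : (2 : ℝ) ^ 65 ≤ d := hB65.trans hBd
  have hτd : τ / d < 1 := by
    rw [div_lt_one hdpos]; norm_num at hd65; linarith only [hd65, hτ4]
  -- (Z) upper bound
  have hZle := zSide_le j B d hBpos hd hlogB
  -- (Y) the three terms
  have hY0 : Real.negMulLog (α / d) = α / d * (Real.log d - Real.log α) := by
    simp only [Real.negMulLog, Real.log_div hαpos.ne' hdpos.ne']; ring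
  have hY2 : Real.negMulLog (γ / d) = γ / d * (Real.log d - Real.log γ) := by
    simp only [Real.negMulLog, Real.log_div hγpos.ne' hdpos.ne']; ring
  have hY1 : τ / d - (τ / d) ^ 2 ≤ Real.negMulLog (1 - τ / d) := sub_sq_le_negMulLog_one_sub hτd
  -- logarithm bounds
  have hlogd : (j + 1) * Real.log 2 ≤ Real.log d := by
    have : Real.log B ≤ Real.log d := Real.log_le_log hBpos hBd
    rw [hlogB] at this; exact this
  have hlogα : Real.log α ≤ Real.log (5 / 2) + 2 / 5 * ((1 + κ) * ε) := by
    have h := Real.log_le_sub_one_of_pos (show 0 < α / (5 / 2) by positivity)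
    rw [Real.log_div hαpos.ne' (by norm_num)] at h
    have e : α / (5 / 2) - 1 = 2 / 5 * ((1 + κ) * ε) := by rw [hα]; ring
    linarith
  have hlogγ : Real.log γ ≤ -Real.log 2 - 2 * ε := by
    have h := Real.log_le_sub_one_of_pos (show 0 < γ / (1 / 2) by positivity)
    rw [Real.log_div hγpos.ne' (by norm_num), Real.log_div one_ne_zero two_ne_zero,
      Real.log_one] at h
    have e : γ / (1 / 2) - 1 = -(2 * ε) := by rw [hγ]; ring
    linarith
  have hl2 := Real.log_two_gt_d9
  have hl2' := Real.log_two_lt_d9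
  have hlog2 : 0 < Real.log 2 := by linarith
  have hP := log_five_halves_le
  have hP0 : 0 ≤ Real.log (5 / 2) := Real.log_nonneg (by norm_num)
  -- the key scaled inequality
  have key : 3 / B + ((3 * j + 1) * Real.log 2) / d ≤
      α / d * (Real.log d - Real.log α) + (τ / d - (τ / d) ^ 2) +
        γ / d * (Real.log d - Real.log γ) := by
    have hA : α * ((j + 1) * Real.log 2 - Real.log (5 / 2) - 2 / 5 * ((1 + κ) * ε)) ≤
        α * (Real.log d - Real.log α) := mul_le_mul_of_nonneg_left (by linarith) hαpos.le
    have hG : γ * ((j + 1) * Real.log 2 + Real.log 2 + 2 * ε) ≤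
        γ * (Real.log d - Real.log γ) := mul_le_mul_of_nonneg_left (by linarith) hγpos.le
    -- expand, using `ε j = 1`
    have hexp : α * ((j + 1) * Real.log 2 - Real.log (5 / 2) - 2 / 5 * ((1 + κ) * ε)) +
        γ * ((j + 1) * Real.log 2 + Real.log 2 + 2 * ε) =
        3 * (j + 1) * Real.log 2 + (κ + 1 / 2) * Real.log 2 - 5 / 2 * Real.log (5 / 2) +
          (κ - 1) * (ε * Real.log 2) - (1 + κ) * (ε * Real.log (5 / 2)) - κ * ε -
          (2 / 5 * (1 + κ) ^ 2 + 2) * ε ^ 2 := by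
      rw [hα, hγ]
      linear_combination (κ * Real.log 2) * hεJ
    -- bounds on the small terms (all `≤ const · ε`)
    have hb1 : 9 / B ≤ 9 * ε := by
      rw [div_le_iff₀ hBpos]; linarith only [hBε]
    have hτ2 : τ ^ 2 ≤ 16 := by
      have h := mul_le_mul hτ4 hτ4 (by linarith only [hτ3]) (by norm_num)
      rw [sq]; linarith only [h]
    have hb2 : τ ^ 2 / d ≤ 16 * ε := by
      calc τ ^ 2 / d ≤ 16 / d := div_le_div_of_nonneg_right hτ2 hdpos.le
        _ ≤ 16 / B := div_le_div_of_nonneg_left (by norm_num) hBpos hBd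
        _ ≤ 16 * ε := by rw [div_le_iff₀ hBpos]; linarith only [hBε]
    have hb3 : 0 ≤ κ * (ε * Real.log 2) := by positivity
    have hb3' : ε * Real.log 2 ≤ 0.7 * ε := by
      have h := mul_le_mul_of_nonneg_left (show Real.log 2 ≤ 0.7 by linarith only [hl2']) hε0.le
      linarith only [h]
    have hb4 : κ * (ε * Real.log (5 / 2)) ≤ ε * Real.log (5 / 2) := by
      have h0 : 0 ≤ ε * Real.log (5 / 2) := by positivity
      have h := mul_le_mul_of_nonneg_right hκ1 h0
      linarith only [h]
    have hb4' : ε * Real.log (5 / 2) ≤ 0.92 * ε := by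
      have h := mul_le_mul_of_nonneg_left (show Real.log (5 / 2) ≤ 0.92 by linarith only [hP])
        hε0.le
      linarith only [h]
    have hb5 : (2 / 5 * (1 + κ) ^ 2 + 2) * ε ^ 2 ≤ 18 / 5 * ε ^ 2 := by
      have h4 : (1 + κ) ^ 2 ≤ 4 := by
        have h := pow_le_pow_left₀ (by positivity : (0 : ℝ) ≤ 1 + κ)
          (show 1 + κ ≤ 2 by linarith only [hκ1]) 2
        linarith only [h, show ((2 : ℝ)) ^ 2 = 4 by norm_num]
      exact mul_le_mul_of_nonneg_right (by linarith only [h4]) (sq_nonneg ε)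
    have hb5' : ε ^ 2 ≤ ε / 1000 := by
      have h := mul_le_mul_of_nonneg_left hεle hε0.le
      calc ε ^ 2 = ε * ε := sq ε
        _ ≤ ε * (1 / 1000) := h
        _ = ε / 1000 := by ring
    have h3dB : 3 * d / B = 3 + 9 / B := by
      rw [hd]; field_simp; ring
    -- the goal multiplied by `d`
    have hscaled : 3 * d / B + (3 * j + 1) * Real.log 2 ≤
        α * (Real.log d - Real.log α) + τ - τ ^ 2 / d + γ * (Real.log d - Real.log γ) := by
      rw [h3dB]
      linarith only [hA, hG, hexp, hb1, hb2, hb3, hb3', hb4, hb4', hb5, hb5', hεδ, hτ, hε0.le]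
    have hdiv := div_le_div_of_nonneg_right hscaled hdpos.le
    have e1 : 3 / B + ((3 * j + 1) * Real.log 2) / d =
        (3 * d / B + (3 * j + 1) * Real.log 2) / d := by
      field_simp
    have e2 : α / d * (Real.log d - Real.log α) + (τ / d - (τ / d) ^ 2) +
        γ / d * (Real.log d - Real.log γ) =
        (α * (Real.log d - Real.log α) + τ - τ ^ 2 / d + γ * (Real.log d - Real.log γ)) / d := by
      field_simp; ring
    rw [e1, e2]; exact hdiv
  linarith only [hZle, hY0, hY1, hY2, key]

set_option maxHeartbeats 800000 in
/-- **`X`-core: `H(Z) ≤ H(X)` along the pencil**, same regime (the `X`-threshold is the weaker one,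
`thresholdX_sub_thresholdY`). [cite: CoppersmithWinograd1990, §8]
[cite: AlmanDuanVassilevskaWilliamsXuXuZhou2025, §3.4] -/
theorem coreX (κ ε j B d σ : ℝ) (hκ0 : 0 ≤ κ) (hκ1 : κ ≤ 1) (hε0 : 0 < ε)
    (hεle : ε ≤ 1 / 1000) (hεJ : ε * j = 1)
    (hεδ : 30 * ε ≤ (5 / 2 + κ) * Real.log 2 - 5 / 2 * Real.log (5 / 2))
    (hB65 : (2 : ℝ) ^ 65 ≤ B) (hBε : 1 ≤ ε * B) (hlogB : Real.log B = (j + 1) * Real.log 2)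
    (hd : d = B + 3) (hσ : σ = 3 + (2 + κ) * ε) :
    Real.negMulLog (2 / d) + Real.negMulLog (B / d) + Real.negMulLog (1 / d) ≤
      Real.negMulLog (1 - σ / d) + Real.negMulLog (σ / d) := by
  have hBpos : 0 < B := lt_of_lt_of_le (by positivity) hB65
  have hdpos : 0 < d := by rw [hd]; linarith
  have hBd : B ≤ d := by rw [hd]; linarith
  have hjε : j = 1 / ε := by rw [eq_div_iff hε0.ne']; linarith only [hεJ]
  have hjpos : 0 < j := by rw [hjε]; positivity
  have hs0 : 0 ≤ σ - 3 := by
    have h : 0 ≤ (2 + κ) * ε := by positivity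
    rw [hσ]; linarith only [h]
  have hs3 : σ - 3 ≤ 3 * ε := by
    have h := mul_le_mul_of_nonneg_right (show 2 + κ ≤ 3 by linarith only [hκ1]) hε0.le
    rw [hσ]; linarith only [h]
  have hσpos : 0 < σ := by linarith only [hs0]
  have hσ4 : σ ≤ 4 := by linarith only [hs3, hεle]
  have hd65 : (2 : ℝ) ^ 65 ≤ d := hB65.trans hBd
  have hσd : σ / d < 1 := by
    rw [div_lt_one hdpos]; norm_num at hd65; linarith only [hd65, hσ4]
  -- (Z) upper bound
  have hZle := zSide_le j B d hBpos hd hlogB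
  -- (X) the two terms
  have hX1 : Real.negMulLog (σ / d) = σ / d * (Real.log d - Real.log σ) := by
    simp only [Real.negMulLog, Real.log_div hσpos.ne' hdpos.ne']; ring
  have hX0 : σ / d - (σ / d) ^ 2 ≤ Real.negMulLog (1 - σ / d) := sub_sq_le_negMulLog_one_sub hσd
  -- logarithm bounds
  have hlogd : (j + 1) * Real.log 2 ≤ Real.log d := by
    have : Real.log B ≤ Real.log d := Real.log_le_log hBpos hBd
    rw [hlogB] at this; exact this
  have hlogσ : Real.log σ ≤ Real.log 3 + (σ - 3) / 3 := by
    have h := Real.log_le_sub_one_of_pos (show 0 < σ / 3 by positivity)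
    rw [Real.log_div hσpos.ne' three_ne_zero] at h
    linarith
  have hl2 := Real.log_two_gt_d9
  have hl2' := Real.log_two_lt_d9
  have hl3 := log_three_le
  have h23 : Real.log 2 ≤ Real.log 3 := Real.log_le_log two_pos (by norm_num)
  have hXY := thresholdX_sub_thresholdY
  -- `(σ − 3) j = 2 + κ`
  have hσJ : (σ - 3) * j = 2 + κ := by rw [hσ]; linear_combination (2 + κ) * hεJ
  -- the key scaled inequality
  have key : 3 / B + ((3 * j + 1) * Real.log 2) / d ≤
      σ / d * (Real.log d - Real.log σ) + (σ / d - (σ / d) ^ 2) := by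
    have hA : σ * ((j + 1) * Real.log 2 - Real.log 3 - (σ - 3) / 3) ≤
        σ * (Real.log d - Real.log σ) := mul_le_mul_of_nonneg_left (by linarith) hσpos.le
    have hexp : σ * ((j + 1) * Real.log 2 - Real.log 3 - (σ - 3) / 3) =
        3 * (j + 1) * Real.log 2 + (2 + κ) * Real.log 2 + (σ - 3) * Real.log 2 -
          σ * Real.log 3 - (σ - 3) - (σ - 3) ^ 2 / 3 := by
      linear_combination Real.log 2 * hσJ
    -- bounds on the small terms
    have hb1 : 9 / B ≤ 9 * ε := by
      rw [div_le_iff₀ hBpos]; linarith only [hBε]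
    have hσ2 : σ ^ 2 ≤ 16 := by
      have h := mul_le_mul hσ4 hσ4 hσpos.le (by norm_num)
      rw [sq]; linarith only [h]
    have hb2 : σ ^ 2 / d ≤ 16 * ε := by
      calc σ ^ 2 / d ≤ 16 / d := div_le_div_of_nonneg_right hσ2 hdpos.le
        _ ≤ 16 / B := div_le_div_of_nonneg_left (by norm_num) hBpos hBd
        _ ≤ 16 * ε := by rw [div_le_iff₀ hBpos]; linarith only [hBε]
    have hb3 : (σ - 3) * (Real.log 3 - Real.log 2) ≤ 3 * ε * 0.412 :=
      mul_le_mul hs3 (by linarith only [hl3, hl2]) (by linarith only [h23]) (by positivity)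
    have hb4 : (σ - 3) ^ 2 / 3 ≤ 3 * ε ^ 2 := by
      have h : (σ - 3) ^ 2 ≤ (3 * ε) ^ 2 := pow_le_pow_left₀ hs0 hs3 2
      have e : (3 * ε) ^ 2 = 9 * ε ^ 2 := by ring
      rw [e] at h; linarith only [h]
    have hb5 : ε ^ 2 ≤ ε / 1000 := by
      have h := mul_le_mul_of_nonneg_left hεle hε0.le
      calc ε ^ 2 = ε * ε := sq ε
        _ ≤ ε * (1 / 1000) := h
        _ = ε / 1000 := by ring
    have h3dB : 3 * d / B = 3 + 9 / B := by
      rw [hd]; field_simp; ring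
    have hscaled : 3 * d / B + (3 * j + 1) * Real.log 2 ≤
        σ * (Real.log d - Real.log σ) + σ - σ ^ 2 / d := by
      rw [h3dB]
      linarith only [hA, hexp, hb1, hb2, hb3, hb4, hb5, hεδ, hXY, hε0.le]
    have hdiv := div_le_div_of_nonneg_right hscaled hdpos.le
    have e1 : 3 / B + ((3 * j + 1) * Real.log 2) / d =
        (3 * d / B + (3 * j + 1) * Real.log 2) / d := by
      field_simp
    have e2 : σ / d * (Real.log d - Real.log σ) + (σ / d - (σ / d) ^ 2) =
        (σ * (Real.log d - Real.log σ) + σ - σ ^ 2 / d) / d := by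
      field_simp; ring
    rw [e1, e2]; exact hdiv
  linarith only [hZle, hX1, hX0, key]

end Summit.MatrixMultiplication.MatrixMultiplication.Theorems.SaturationLadderTwinCeilingCore
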